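import Summits.PneNP.PneNP.Theorems.ConvexRankGatesConvexGateBlindExactLiftingStrictJump

/-!
# Uniform isolation of the WHOLE FAMILY of minimal factorisations ⇔ an ε-uniform strict-rank jump (abstract form)

Support file for crux `ConvexGateBlind` (stmt-PneNP-10680), open stub `stub_exactLifting`; prover seat 0, session 35,
memo ANALYSIS14 §4. The abstract engine `XorDoor.jump_of_unique_isolated` (session 28) asks for TERMWISE UNIQUENESS of
the minimal non-negative factorisation of `m` up to relabelling — which fails for the triangle matrix because of its
degenerate rows (`…TriangleJumpVacuous`). The right abstraction needs no uniqueness at all: an ε-uniform jump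
(`m − ε` has no `ι`-indexed non-negative factorisation for all small `ε > 0`) holds as soon as the family of ALL
`ι`-indexed non-negative factorisations of the unshifted `m` is UNIFORMLY ISOLATED from strict ones — one `δ > 0` such that
every factorisation of some `m − ε` whose terms are entrywise `δ`-close to the terms of SOME factorisation of `m` has
`ε ≤ 0` (`jump_of_isolated_family`). Conversely the jump trivially gives uniform isolation (`isolated_family_of_jump`,
with any `δ`), so this is an EQUIVALENCE (`jump_iff_isolated_family`): classification results (such as R1′ of
`…TriangleJumpGen`) serve only to DESCRIBE the family so that isolation can be proved member by member, with a uniform `δ`.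
Proof of the non-trivial direction: limits of strict factorisations along `ε_n → 0⁺` (`exists_limit_nmf`, compactness)
are members of the family, with termwise convergence — contradicting isolation at a late stage.
Registered sub-goal `strict_jump_iff_isolated_family` (Mathlib vocabulary only).
-/

set_option linter.dupNamespace false -- `Summit.PneNP.PneNP.…`: summit = sub-problem (D-0017)

namespace Summit.PneNP.PneNP.Theorems.XorDoor

open Filter Topology Finset

/-- **Uniform isolation of the family of minimal factorisations ⇒ ε-uniform jump** (abstract; no uniqueness needed). -/
theorem jump_of_isolated_family {ι X W : Type} [Fintype ι] [Fintype X] [Fintype W] (m : X → W → ℝ)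
    (hiso : ∃ δ : ℝ, 0 < δ ∧ ∀ (u₀ : ι → X → ℝ) (v₀ : ι → W → ℝ), (∀ i x, 0 ≤ u₀ i x) → (∀ i w, 0 ≤ v₀ i w) →
      (∀ x w, ∑ i, u₀ i x * v₀ i w = m x w) → ∀ (ε : ℝ) (u : ι → X → ℝ) (v : ι → W → ℝ), (∀ i x, 0 ≤ u i x) →
      (∀ i w, 0 ≤ v i w) → (∀ x w, ∑ i, u i x * v i w = m x w - ε) →
      (∀ i x w, |u i x * v i w - u₀ i x * v₀ i w| < δ) → ε ≤ 0) :
    ∃ ε₀ : ℝ, 0 < ε₀ ∧ ∀ ε : ℝ, 0 < ε → ε < ε₀ → ∀ (u : ι → X → ℝ) (v : ι → W → ℝ),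
      (∀ i x, 0 ≤ u i x) → (∀ i w, 0 ≤ v i w) → ¬ ∀ x w, ∑ i, u i x * v i w = m x w - ε := by
  classical
  obtain ⟨δ, hδ, hiso⟩ := hiso
  by_contra hcon
  push Not at hcon
  -- a sequence of strict factorisations with shifts `ε n ∈ (0, 1/(n+1))`
  have hseq : ∀ n : ℕ, ∃ ε : ℝ, 0 < ε ∧ ε < 1 / ((n : ℝ) + 1) ∧ ∃ (u : ι → X → ℝ) (v : ι → W → ℝ),
      (∀ i x, 0 ≤ u i x) ∧ (∀ i w, 0 ≤ v i w) ∧ ∀ x w, ∑ i, u i x * v i w = m x w - ε := by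
    intro n
    obtain ⟨ε, hε0, hε1, u, v, hu, hv, hf⟩ := hcon (1 / ((n : ℝ) + 1)) (by positivity)
    exact ⟨ε, hε0, hε1, u, v, hu, hv, hf⟩
  choose ε hε0 hε1 u v hu hv hf using hseq
  have hεlim : Tendsto ε atTop (𝓝 0) := by
    refine squeeze_zero (fun n => (hε0 n).le) (fun n => (hε1 n).le) ?_
    exact tendsto_one_div_add_atTop_nhds_zero_nat
  -- the limit factorisation of `m` (a member of the family) and termwise convergence along a subsequence
  obtain ⟨u₀, v₀, hu₀, hv₀, hf₀, φ, hφ, hterm⟩ := exists_limit_nmf m ε hεlim u v hu hv hf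
  -- eventually every term is `δ`-close to the corresponding limit term
  have hev : ∀ᶠ n in atTop, ∀ i x w, |u (φ n) i x * v (φ n) i w - u₀ i x * v₀ i w| < δ := by
    refine eventually_all.2 fun i => eventually_all.2 fun x => eventually_all.2 fun w => ?_
    have := Metric.tendsto_nhds.1 (hterm i x w) δ hδ
    simpa only [Real.dist_eq] using this
  obtain ⟨n, hn⟩ := hev.exists
  have := hiso u₀ v₀ hu₀ hv₀ hf₀ (ε (φ n)) (u (φ n)) (v (φ n)) (hu _) (hv _) (hf _) hn
  linarith [hε0 (φ n)]

/-- **The converse is trivial**: an ε-uniform jump gives uniform isolation of the family. If `m − ε` and `m` have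
`ι`-indexed factorisations at termwise distance `< δ`, summing over `i` at any one entry gives `|ε| ≤ #ι · δ`; so with
`δ := ε₀ / (#ι + 1)` closeness forces `ε < ε₀`, and then the jump (no strict factorisation for `0 < ε < ε₀`) forces
`ε ≤ 0`. (Index types of rows and columns non-empty.) -/
theorem isolated_family_of_jump {ι X W : Type} [Fintype ι] [Fintype X] [Fintype W] [Nonempty X] [Nonempty W]
    (m : X → W → ℝ)
    (hjump : ∃ ε₀ : ℝ, 0 < ε₀ ∧ ∀ ε : ℝ, 0 < ε → ε < ε₀ → ∀ (u : ι → X → ℝ) (v : ι → W → ℝ),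
      (∀ i x, 0 ≤ u i x) → (∀ i w, 0 ≤ v i w) → ¬ ∀ x w, ∑ i, u i x * v i w = m x w - ε) :
    ∃ δ : ℝ, 0 < δ ∧ ∀ (u₀ : ι → X → ℝ) (v₀ : ι → W → ℝ), (∀ i x, 0 ≤ u₀ i x) → (∀ i w, 0 ≤ v₀ i w) →
      (∀ x w, ∑ i, u₀ i x * v₀ i w = m x w) → ∀ (ε : ℝ) (u : ι → X → ℝ) (v : ι → W → ℝ), (∀ i x, 0 ≤ u i x) →
      (∀ i w, 0 ≤ v i w) → (∀ x w, ∑ i, u i x * v i w = m x w - ε) →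
      (∀ i x w, |u i x * v i w - u₀ i x * v₀ i w| < δ) → ε ≤ 0 := by
  classical
  obtain ⟨ε₀, hε₀, hjump⟩ := hjump
  refine ⟨ε₀ / (Fintype.card ι + 1), by positivity, ?_⟩
  intro u₀ v₀ _ _ hf₀ ε u v hu hv hf hclose
  by_contra hpos
  push Not at hpos
  -- closeness bounds the shift: `|ε| ≤ #ι · δ < ε₀`
  obtain ⟨x⟩ := ‹Nonempty X›
  obtain ⟨w⟩ := ‹Nonempty W›
  have hsum : |∑ i, (u i x * v i w - u₀ i x * v₀ i w)| ≤ ∑ i, |u i x * v i w - u₀ i x * v₀ i w| :=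
    abs_sum_le_sum_abs _ _
  have hlt : ∑ i, |u i x * v i w - u₀ i x * v₀ i w| ≤ ∑ _i : ι, ε₀ / (Fintype.card ι + 1) :=
    sum_le_sum fun i _ => (hclose i x w).le
  rw [sum_const, card_univ, nsmul_eq_mul] at hlt
  have hε : ε = -(∑ i, (u i x * v i w - u₀ i x * v₀ i w)) := by
    rw [sum_sub_distrib, hf x w, hf₀ x w]; ring
  have hcard : (0 : ℝ) ≤ Fintype.card ι := Nat.cast_nonneg _
  have hεlt : ε < ε₀ := by
    have h1 : |ε| ≤ Fintype.card ι * (ε₀ / (Fintype.card ι + 1)) := by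
      rw [hε, abs_neg]; exact hsum.trans hlt
    have h2 : Fintype.card ι * (ε₀ / (Fintype.card ι + 1)) < ε₀ := by
      rw [mul_div_assoc']
      rw [div_lt_iff₀ (by positivity)]
      nlinarith
    exact (le_abs_self ε).trans_lt (h1.trans_lt h2)
  exact hjump ε hpos hεlt u v hu hv hf

/-- **ε-uniform jump ⇔ uniform isolation of the family of factorisations of the unshifted matrix** (abstract). -/
theorem jump_iff_isolated_family {ι X W : Type} [Fintype ι] [Fintype X] [Fintype W] [Nonempty X] [Nonempty W]
    (m : X → W → ℝ) :
    (∃ ε₀ : ℝ, 0 < ε₀ ∧ ∀ ε : ℝ, 0 < ε → ε < ε₀ → ∀ (u : ι → X → ℝ) (v : ι → W → ℝ),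
      (∀ i x, 0 ≤ u i x) → (∀ i w, 0 ≤ v i w) → ¬ ∀ x w, ∑ i, u i x * v i w = m x w - ε) ↔
    (∃ δ : ℝ, 0 < δ ∧ ∀ (u₀ : ι → X → ℝ) (v₀ : ι → W → ℝ), (∀ i x, 0 ≤ u₀ i x) → (∀ i w, 0 ≤ v₀ i w) →
      (∀ x w, ∑ i, u₀ i x * v₀ i w = m x w) → ∀ (ε : ℝ) (u : ι → X → ℝ) (v : ι → W → ℝ), (∀ i x, 0 ≤ u i x) →
      (∀ i w, 0 ≤ v i w) → (∀ x w, ∑ i, u i x * v i w = m x w - ε) →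
      (∀ i x w, |u i x * v i w - u₀ i x * v₀ i w| < δ) → ε ≤ 0) :=
  ⟨isolated_family_of_jump m, jump_of_isolated_family m⟩

/-- **ε-uniform strict-rank jump ⇔ uniform isolation of the family of minimal factorisations, registered form**
(sub-goal `strict_jump_iff_isolated_family` of stmt-PneNP-10680, verbatim signature; Mathlib vocabulary only). -/
theorem strict_jump_iff_isolated_family : ∀ (ι X W : Type) [Fintype ι] [Fintype X] [Fintype W] [Nonempty X]
    [Nonempty W] (m : X → W → ℝ), (∃ ε₀ : ℝ, 0 < ε₀ ∧ ∀ ε : ℝ, 0 < ε → ε < ε₀ → ∀ (u : ι → X → ℝ) (v : ι → W →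
    ℝ), (∀ i x, 0 ≤ u i x) → (∀ i w, 0 ≤ v i w) → ¬ ∀ x w, ∑ i, u i x * v i w = m x w - ε) ↔ (∃ δ : ℝ, 0 < δ ∧ ∀
    (u₀ : ι → X → ℝ) (v₀ : ι → W → ℝ), (∀ i x, 0 ≤ u₀ i x) → (∀ i w, 0 ≤ v₀ i w) → (∀ x w, ∑ i, u₀ i x * v₀ i w = m
    x w) → ∀ (ε : ℝ) (u : ι → X → ℝ) (v : ι → W → ℝ), (∀ i x, 0 ≤ u i x) → (∀ i w, 0 ≤ v i w) → (∀ x w, ∑ i, u i x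
    * v i w = m x w - ε) → (∀ i x w, |u i x * v i w - u₀ i x * v₀ i w| < δ) → ε ≤ 0) :=
  fun _ _ _ _ _ _ _ _ m => jump_iff_isolated_family m

end Summit.PneNP.PneNP.Theorems.XorDoor
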